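import Mathlib
import Summits.NavierStokesRegularity.NavierStokesRegularity.Theorems.LerayQuarterDissipationFiniteDissipationLiouvilleWindowSocketCollar
import Summits.NavierStokesRegularity.NavierStokesRegularity.Theorems.LerayQuarterDissipationFiniteDissipationLiouvilleWindowFastTimes
import HarnessLib

/-!
# Crux `FiniteDissipationLiouville` (stmt-NavierStokesRegularity-22144): SUPER-SELF-SIMILARITY BY A
# DEFINITE MARGIN IN EVERY WINDOW, AND THE ONE-WINDOW REGULARITY CRITERIA

Theorems file of route `LerayQuarterDissipation` (lead prover g19; `--supports` the crux; instances of
`…WindowSocketCollar`, sequel of `…WindowRecurrence`, `…WindowVolumeScaling`, `…WindowFastTimes`).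
Navier–Stokes regularity is NOT proved by anything here; no summit is.

* **`speed_exceeds_margin_in_every_window`** / **`speed_exceeds_margin_volume(_scaled)`** — for every
  `A` there are `ε = ε(A) ∈ (0,1)`, a MARGIN `δ = δ(A) > 0` (and `η(A) > 0`) such that every SINGULAR
  KNSS-gauge Type-I field (`IsTypeIAncientMild C V`, `C ≤ A`) with a Type-I envelope
  `HasTypeIDecay A V` has in EVERY window `[−c², −εc²] × ℝ³` a point — indeed a set of volume
  `≥ η c⁵` — where `√(−t)‖V(t,x)‖ > 1 + δ`: the speed exceeds the self-similar rate BY A DEFINITE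
  FACTOR, recurrently with bounded gaps, at every scale (lead g18's collar `…LambProduct.exists_timeConstant_gap`
  «`√(−t)‖V‖ ≤ 1+ε` everywhere ⇒ not singular» gave ONE such point; `…WindowRecurrence` gave the
  window/volume form at margin `0`);
* **`localBalance_excess_margin_in_every_window`** / **`…_volume`** — the same for the Lamb-form
  production excess BY A FACTOR: `(1+δ)(‖curl ω‖² + ‖ω‖²/(4(−t))) < ⟪V, ω × curl ω⟫` on a set of
  definite volume in every window;
* THE ONE-WINDOW REGULARITY CRITERIA (contrapositives, law-free, for the enveloped Type-I class):
  **`not_singular_of_slow_window`** — if `√(−t)‖V‖ ≤ 1 + δ(A)` throughout ONE window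
  `[−c², −ε(A)c²] × ℝ³` (any `c > 0`), the field is not singular at the apex (`|log ε(A)|` e-folds of
  sub-threshold speed suffice — compare g18's `not_singular_of_speed_le_one_near_apex`, which needs
  the whole final slab `[τ, 0)`); **`not_singular_of_small_fast_volume`** — if in ONE window the fast
  set `{√(−t)‖V‖ > 1 + δ}` has volume `< η(A) c⁵`, not singular; **`not_singular_of_few_fast_times`** —
  if in ONE window the instants carrying a fast point (`> 1`) have measure `< κ(A) c²`, not singular.

HONEST FRAMING. Compactness corollaries (ineffective `ε, δ, η, κ`) about a HYPOTHETICAL singular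
enveloped profile, resp. ε-regularity-type criteria with ineffective thresholds for the enveloped
Type-I class; nothing is removed from the DSS wall (`∀ c>1 TypeIDSSLiouville c`, NECESSARY for the
crux). Nothing here bears on NS regularity.

References: Koch–Nadirashvili–Seregin–Šverák, Acta Math. 203 (2009) §4; folklore.
-/

noncomputable section

set_option linter.dupNamespace false

namespace Summit.NavierStokesRegularity.NavierStokesRegularity.Theorems.FiniteDissipationLiouville.WindowRecurrence

open MeasureTheory Set Filter Topology Metric InnerProductSpace Function Real
open scoped RealInnerProductSpace ContDiff ENNReal
open Literature.Analysis Literature.Analysis.FluidPDE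
open Summit.NavierStokesRegularity.NavierStokesRegularity.Theorems
open Summit.NavierStokesRegularity.NavierStokesRegularity.Theorems.RecurrentReductionD
open Summit.NavierStokesRegularity.NavierStokesRegularity.Theorems.FiniteDissipationLiouville
open Summit.NavierStokesRegularity.NavierStokesRegularity.Theorems.FiniteDissipationLiouville.CrossFlow
open Summit.NavierStokesRegularity.NavierStokesRegularity.Theorems.FiniteDissipationLiouville.EndpointScheme
open Summit.NavierStokesRegularity.NavierStokesRegularity.Theorems.FiniteDissipationLiouville.LambProduct
open Summit.NavierStokesRegularity.NavierStokesRegularity.Theorems.FiniteDissipationLiouville.LocalBalance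
open Summit.NavierStokesRegularity.NavierStokesRegularity.Theorems.FiniteDissipationLiouville.WindowSocket

variable {C : ℝ} {V : ℝ → EuclideanSpace ℝ (Fin 3) → EuclideanSpace ℝ (Fin 3)}

/-! ### The speed family `√(−t)‖V‖ ≤ θ` -/

section Speed

/-- Pointwise scale covariance of «speed `≤ θ`». [folklore] -/
theorem speed_le_at_nsRescale (θ : ℝ) (V : ℝ → EuclideanSpace ℝ (Fin 3) → EuclideanSpace ℝ (Fin 3))
    {c t : ℝ} (x : EuclideanSpace ℝ (Fin 3)) (hc : 0 < c) (ht : t < 0)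
    (h : Real.sqrt (-(c ^ 2 * t)) * ‖V (c ^ 2 * t) (c • x)‖ ≤ θ) :
    Real.sqrt (-t) * ‖nsRescale c V t x‖ ≤ θ := by
  have e : Real.sqrt (-(c ^ 2 * t)) = c * Real.sqrt (-t) := by
    rw [show -(c ^ 2 * t) = c ^ 2 * (-t) by ring, Real.sqrt_mul' _ (neg_nonneg.2 ht.le),
      Real.sqrt_sq hc.le]
  rw [nsRescale_apply, norm_smul, Real.norm_of_nonneg hc.le]
  rw [e] at h
  linarith [h]

/-- Violations of «speed `≤ 1`» by a KNSS limit force violations of «speed `≤ θ_j`», `θ_j → 1`, by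
the approximants. [folklore] -/
theorem speed_violation_eventually {v : ℕ → ℝ → EuclideanSpace ℝ (Fin 3) → EuclideanSpace ℝ (Fin 3)}
    {W : ℝ → EuclideanSpace ℝ (Fin 3) → EuclideanSpace ℝ (Fin 3)} {θ : ℕ → ℝ}
    (hpt : ∀ t < 0, ∀ x, Tendsto (fun j => v j t x) atTop (𝓝 (W t x)))
    (hθ : Tendsto θ atTop (𝓝 1)) {t : ℝ} (ht : t < 0) (x : EuclideanSpace ℝ (Fin 3))
    (hbad : ¬ Real.sqrt (-t) * ‖W t x‖ ≤ 1) :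
    ∀ᶠ j in atTop, ¬ Real.sqrt (-t) * ‖v j t x‖ ≤ θ j := by
  have hL : Tendsto (fun j => Real.sqrt (-t) * ‖v j t x‖) atTop (𝓝 (Real.sqrt (-t) * ‖W t x‖)) :=
    ((hpt t ht x).norm).const_mul _
  rw [not_le] at hbad
  filter_upwards [hθ.eventually_lt hL hbad] with j hj
  exact not_le.2 hj

/-- The violation set of «speed `≤ θ`» is open. [folklore] -/
theorem isOpen_speed_violation (hV : IsTypeIAncientMild C V) (θ : ℝ) :
    IsOpen {p : ℝ × EuclideanSpace ℝ (Fin 3) | p.1 < 0 ∧ ¬ Real.sqrt (-p.1) * ‖V p.1 p.2‖ ≤ θ} := by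
  have hS : IsOpen (Iio (0:ℝ) ×ˢ (univ : Set (EuclideanSpace ℝ (Fin 3)))) :=
    isOpen_Iio.prod isOpen_univ
  have hf : ContinuousOn (fun p : ℝ × EuclideanSpace ℝ (Fin 3) => Real.sqrt (-p.1) * ‖V p.1 p.2‖)
      (Iio 0 ×ˢ univ) :=
    (continuous_fst.neg.sqrt).continuousOn.mul (continuousOn_val hV).norm
  have hO := hf.isOpen_inter_preimage hS (isOpen_Ioi (a := θ))
  convert hO using 1
  ext p
  simp only [mem_setOf_eq, mem_inter_iff, mem_prod, mem_Iio, mem_univ, and_true, mem_preimage,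
    mem_Ioi, not_le]

/-- **THE SPEED EXCEEDS THE SELF-SIMILAR RATE BY A DEFINITE FACTOR IN EVERY WINDOW.** For every `A`
there are `ε = ε(A) ∈ (0,1)` and `δ = δ(A) > 0` such that every SINGULAR KNSS-gauge Type-I field
(`IsTypeIAncientMild C V`, `C ≤ A`) with a Type-I envelope `HasTypeIDecay A V` has in every window
`[−c², −εc²]`, `c > 0`, a point with `1 + δ < √(−t)‖V(t,x)‖`.
[folklore energy method + KNSS compactness; cite: KochNadirashviliSereginSverak2009, §4 (arXiv:0709.3599 p. 8)] -/
theorem speed_exceeds_margin_in_every_window (A : ℝ) : ∃ ε : ℝ, 0 < ε ∧ ε < 1 ∧ ∃ δ : ℝ, 0 < δ ∧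
    ∀ (C : ℝ) (V : ℝ → EuclideanSpace ℝ (Fin 3) → EuclideanSpace ℝ (Fin 3)),
      IsTypeIAncientMild C V → C ≤ A → HasTypeIDecay A V →
      (∀ r > 0, ∀ M : ℝ, ∃ t ∈ Ioo (-(r ^ 2)) (0 : ℝ),
        ∃ x ∈ ball (0 : EuclideanSpace ℝ (Fin 3)) r, M < ‖V t x‖) →
      ∀ c : ℝ, 0 < c → ∃ t ∈ Icc (-c ^ 2) (-(ε * c ^ 2)), ∃ x : EuclideanSpace ℝ (Fin 3),
        1 + δ < Real.sqrt (-t) * ‖V t x‖ := by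
  obtain ⟨ε, hε, hε1, δ, hδ, h⟩ := exists_window_margin_of_apex_kill_envelope (C := A) (θ₀ := 1)
    (G := fun θ F t x => Real.sqrt (-t) * ‖F t x‖ ≤ θ)
    (fun θ F c t x hc ht hG => speed_le_at_nsRescale θ F x hc ht hG)
    (fun u W θ hu hW hunif hpt hgr hθ t ht x hbad => speed_violation_eventually hpt hθ ht x hbad)
    (fun W hW hdW hG => not_singular_of_speed_le_one_near_apex hW hdW (τ := -1/2) (by norm_num)
      fun t h1 h2 x => hG t (by linarith) h2 x)
  refine ⟨ε, hε, hε1, δ, hδ, fun C V hV hCA hdec hsing c hc => ?_⟩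
  obtain ⟨t, ht, x, hx⟩ := h V (isTypeIAncientMild_of_le hV hCA) hdec hsing c hc
  exact ⟨t, ht, x, not_le.1 hx⟩

/-- **THE SET `{√(−t)‖V‖ > 1 + δ}` HAS DEFINITE VOLUME IN THE UNIT WINDOW.** [folklore energy method +
KNSS compactness; cite: KochNadirashviliSereginSverak2009, §4 (arXiv:0709.3599 p. 8)] -/
theorem speed_exceeds_margin_volume (A : ℝ) : ∃ ε : ℝ, 0 < ε ∧ ε < 1 ∧ ∃ δ : ℝ, 0 < δ ∧
    ∃ η : ℝ, 0 < η ∧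
    ∀ (C : ℝ) (V : ℝ → EuclideanSpace ℝ (Fin 3) → EuclideanSpace ℝ (Fin 3)),
      IsTypeIAncientMild C V → C ≤ A → HasTypeIDecay A V →
      (∀ r > 0, ∀ M : ℝ, ∃ t ∈ Ioo (-(r ^ 2)) (0 : ℝ),
        ∃ x ∈ ball (0 : EuclideanSpace ℝ (Fin 3)) r, M < ‖V t x‖) →
      ENNReal.ofReal η ≤ volume {p : ℝ × EuclideanSpace ℝ (Fin 3) | p.1 ∈ Icc (-1 : ℝ) (-ε) ∧
        1 + δ < Real.sqrt (-p.1) * ‖V p.1 p.2‖} := by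
  obtain ⟨ε, hε, hε1, δ, hδ, η, hη, h⟩ := exists_window_margin_volume_of_apex_kill_envelope (C := A)
    (θ₀ := 1) (G := fun θ F t x => Real.sqrt (-t) * ‖F t x‖ ≤ θ)
    (fun u W θ hu hW hunif hpt hgr hθ t ht x hbad => speed_violation_eventually hpt hθ ht x hbad)
    (fun θ U hU _ => isOpen_speed_violation hU θ)
    (fun W hW hdW hG => not_singular_of_speed_le_one_near_apex hW hdW (τ := -1/2) (by norm_num)
      fun t h1 h2 x => hG t (by linarith) h2 x)
  refine ⟨ε, hε, hε1, δ, hδ, η, hη, fun C V hV hCA hdec hsing => ?_⟩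
  exact (h V (isTypeIAncientMild_of_le hV hCA) hdec hsing).trans
    (measure_mono fun p hp => ⟨hp.1, not_le.1 hp.2⟩)

/-- **… AND VOLUME `≥ η c⁵` IN EVERY WINDOW `[−c², −εc²]`.** [folklore; cite: KochNadirashviliSereginSverak2009, §4 (arXiv:0709.3599 p. 8)] -/
theorem speed_exceeds_margin_volume_scaled (A : ℝ) : ∃ ε : ℝ, 0 < ε ∧ ε < 1 ∧ ∃ δ : ℝ, 0 < δ ∧
    ∃ η : ℝ, 0 < η ∧
    ∀ (C : ℝ) (V : ℝ → EuclideanSpace ℝ (Fin 3) → EuclideanSpace ℝ (Fin 3)),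
      IsTypeIAncientMild C V → C ≤ A → HasTypeIDecay A V →
      (∀ r > 0, ∀ M : ℝ, ∃ t ∈ Ioo (-(r ^ 2)) (0 : ℝ),
        ∃ x ∈ ball (0 : EuclideanSpace ℝ (Fin 3)) r, M < ‖V t x‖) →
      ∀ c : ℝ, 0 < c →
      ENNReal.ofReal (η * c ^ 5) ≤ volume {p : ℝ × EuclideanSpace ℝ (Fin 3) |
        p.1 ∈ Icc (-c ^ 2) (-(ε * c ^ 2)) ∧ 1 + δ < Real.sqrt (-p.1) * ‖V p.1 p.2‖} := by
  obtain ⟨ε, hε, hε1, δ, hδ, η, hη, h⟩ := speed_exceeds_margin_volume A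
  refine ⟨ε, hε, hε1, δ, hδ, η, hη, fun C V hV hCA hdec hsing c hc => ?_⟩
  have h1 := h C (nsRescale c V) (hV.nsRescale hc) hCA (hdec.nsRescale hc)
    (singularAtOrigin_nsRescale hsing hc)
  have h2 := volume_window_scaled (G := fun F t x => Real.sqrt (-t) * ‖F t x‖ ≤ 1 + δ)
    (fun F c' t x hc' ht hG => speed_le_at_nsRescale (1 + δ) F x hc' ht hG) hε hc (V := V) (η := η)
    (h1.trans (measure_mono fun p hp => ⟨hp.1, not_le.2 hp.2⟩))
  exact h2.trans (measure_mono fun p hp => ⟨hp.1, not_le.1 hp.2⟩)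

end Speed

/-! ### The Lamb-form balance with a factor `θ` -/

section Balance

/-- Pointwise scale covariance of the Lamb-form balance with factor `θ`. [folklore] -/
theorem localBalance_factor_at_nsRescale (θ : ℝ) (V : ℝ → EuclideanSpace ℝ (Fin 3) → EuclideanSpace ℝ (Fin 3))
    {c t : ℝ} (x : EuclideanSpace ℝ (Fin 3)) (hc : 0 < c) (ht : t < 0)
    (h : ⟪V (c ^ 2 * t) (c • x), cross (curl (V (c ^ 2 * t)) (c • x)) (curl (curl (V (c ^ 2 * t))) (c • x))⟫ ≤
      θ * (‖curl (curl (V (c ^ 2 * t))) (c • x)‖ ^ 2 +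
        ‖curl (V (c ^ 2 * t)) (c • x)‖ ^ 2 / (4 * (-(c ^ 2 * t))))) :
    ⟪nsRescale c V t x, cross (curl (nsRescale c V t) x) (curl (curl (nsRescale c V t)) x)⟫ ≤
      θ * (‖curl (curl (nsRescale c V t)) x‖ ^ 2 + ‖curl (nsRescale c V t) x‖ ^ 2 / (4 * (-t))) := by
  -- adapted from `…LocalBalanceApex.localBalance_nsRescale_from` (pointwise form)
  have hcurl : curl (nsRescale c V t) x = (c * c) • curl (V (c ^ 2 * t)) (c • x) := by
    rw [curl_eq_curlCLM, fderiv_nsRescale, map_smul, ← curl_eq_curlCLM]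
  rw [hcurl, curl_curl_nsRescale, nsRescale_apply, cross_smul_left, cross_smul_right,
    real_inner_smul_left, real_inner_smul_right, real_inner_smul_right, norm_smul, norm_smul,
    Real.norm_of_nonneg (by positivity : (0:ℝ) ≤ c * c),
    Real.norm_of_nonneg (by positivity : (0:ℝ) ≤ c * c * c)]
  have ht' : 0 < -t := neg_pos.2 ht
  have h4 : (4 : ℝ) * (-t) ≠ 0 := by positivity
  have h4c : (4 : ℝ) * (-(c ^ 2 * t)) ≠ 0 := by
    rw [show (4 : ℝ) * (-(c ^ 2 * t)) = c ^ 2 * (4 * (-t)) by ring]; positivity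
  have e1 : (c * c * ‖curl (V (c ^ 2 * t)) (c • x)‖) ^ 2 / (4 * (-t)) =
      c ^ 6 * (‖curl (V (c ^ 2 * t)) (c • x)‖ ^ 2 / (4 * (-(c ^ 2 * t)))) := by
    rw [mul_div_assoc', div_eq_div_iff h4 h4c]
    ring
  have e : (c * c * c * ‖curl (curl (V (c ^ 2 * t))) (c • x)‖) ^ 2 +
      (c * c * ‖curl (V (c ^ 2 * t)) (c • x)‖) ^ 2 / (4 * (-t)) =
      c ^ 6 * (‖curl (curl (V (c ^ 2 * t))) (c • x)‖ ^ 2 +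
        ‖curl (V (c ^ 2 * t)) (c • x)‖ ^ 2 / (4 * (-(c ^ 2 * t)))) := by
    rw [e1]
    ring
  rw [e]
  have hw : 0 ≤ c ^ 6 := by positivity
  calc c * (c * c * (c * c * c *
        ⟪V (c ^ 2 * t) (c • x), cross (curl (V (c ^ 2 * t)) (c • x)) (curl (curl (V (c ^ 2 * t))) (c • x))⟫))
      = c ^ 6 * ⟪V (c ^ 2 * t) (c • x), cross (curl (V (c ^ 2 * t)) (c • x))
          (curl (curl (V (c ^ 2 * t))) (c • x))⟫ := by ring
    _ ≤ c ^ 6 * (θ * (‖curl (curl (V (c ^ 2 * t))) (c • x)‖ ^ 2 +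
        ‖curl (V (c ^ 2 * t)) (c • x)‖ ^ 2 / (4 * (-(c ^ 2 * t))))) := mul_le_mul_of_nonneg_left h hw
    _ = _ := by ring

/-- Violations of the Lamb balance (factor `1`) by a KNSS limit force violations with factors
`θ_j → 1` by the approximants. [cite: KochNadirashviliSereginSverak2009, Prop. 4.1 (arXiv:0709.3599 p. 8)] -/
theorem localBalance_factor_violation_eventually
    {v : ℕ → ℝ → EuclideanSpace ℝ (Fin 3) → EuclideanSpace ℝ (Fin 3)}
    {W : ℝ → EuclideanSpace ℝ (Fin 3) → EuclideanSpace ℝ (Fin 3)} {θ : ℕ → ℝ}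
    (hv : ∀ j, IsTypeIAncientMild C (v j)) (hW : IsTypeIAncientMild C W)
    (hunif : ∀ n : ℕ, TendstoUniformlyOn (fun j z => v j z.1 z.2) (fun z => W z.1 z.2) atTop
      (Icc (-((n : ℝ) + 2)) (-(1 / ((n : ℝ) + 2))) ×ˢ
        closedBall (0 : EuclideanSpace ℝ (Fin 3)) ((n : ℝ) + 2)))
    (hpt : ∀ t < 0, ∀ x, Tendsto (fun j => v j t x) atTop (𝓝 (W t x)))
    (hgr : ∀ t < 0, ∀ x, Tendsto (fun j => fderiv ℝ (v j t) x) atTop (𝓝 (fderiv ℝ (W t) x)))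
    (hθ : Tendsto θ atTop (𝓝 1)) {t : ℝ} (ht : t < 0) (x : EuclideanSpace ℝ (Fin 3))
    (hbad : ¬ ⟪W t x, cross (curl (W t) x) (curl (curl (W t)) x)⟫ ≤
      1 * (‖curl (curl (W t)) x‖ ^ 2 + ‖curl (W t) x‖ ^ 2 / (4 * (-t)))) :
    ∀ᶠ j in atTop, ¬ ⟪v j t x, cross (curl (v j t) x) (curl (curl (v j t)) x)⟫ ≤
      θ j * (‖curl (curl (v j t)) x‖ ^ 2 + ‖curl (v j t) x‖ ^ 2 / (4 * (-t))) := by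
  have hta : Tendsto (fun j => v j t x) atTop (𝓝 (W t x)) := hpt t ht x
  have htb : Tendsto (fun j => curl (v j t) x) atTop (𝓝 (curl (W t) x)) :=
    tendsto_curl_of_fderiv (hgr t ht x)
  have htd : Tendsto (fun j => curl (curl (v j t)) x) atTop (𝓝 (curl (curl (W t)) x)) :=
    tendsto_curl_curl_of_unif hv hW hunif ht x
  have hcr : Tendsto (fun j => cross (curl (v j t) x) (curl (curl (v j t)) x)) atTop
      (𝓝 (cross (curl (W t) x) (curl (curl (W t)) x))) := by
    have h := ((crossCLM.continuous₂).tendsto (curl (W t) x, curl (curl (W t)) x)).comp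
      (htb.prodMk_nhds htd)
    refine h.congr fun j => ?_
    simp [Function.comp, crossCLM_apply]
  have hL : Tendsto (fun j => ⟪v j t x, cross (curl (v j t) x) (curl (curl (v j t)) x)⟫) atTop
      (𝓝 ⟪W t x, cross (curl (W t) x) (curl (curl (W t)) x)⟫) := hta.inner hcr
  have hR : Tendsto (fun j => θ j * (‖curl (curl (v j t)) x‖ ^ 2 + ‖curl (v j t) x‖ ^ 2 / (4 * (-t))))
      atTop (𝓝 (1 * (‖curl (curl (W t)) x‖ ^ 2 + ‖curl (W t) x‖ ^ 2 / (4 * (-t))))) :=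
    hθ.mul ((htd.norm.pow 2).add ((htb.norm.pow 2).div_const _))
  rw [not_le] at hbad
  filter_upwards [hR.eventually_lt hL hbad] with j hj
  exact not_le.2 hj

/-- The violation set of the Lamb balance with factor `θ` is open. [folklore] -/
theorem isOpen_localBalance_factor_violation (hV : IsTypeIAncientMild C V) (θ : ℝ) :
    IsOpen {p : ℝ × EuclideanSpace ℝ (Fin 3) | p.1 < 0 ∧
      ¬ ⟪V p.1 p.2, cross (curl (V p.1) p.2) (curl (curl (V p.1)) p.2)⟫ ≤
        θ * (‖curl (curl (V p.1)) p.2‖ ^ 2 + ‖curl (V p.1) p.2‖ ^ 2 / (4 * (-p.1)))} := by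
  have hS : IsOpen (Iio (0:ℝ) ×ˢ (univ : Set (EuclideanSpace ℝ (Fin 3)))) :=
    isOpen_Iio.prod isOpen_univ
  have ha := continuousOn_val hV
  have hb := continuousOn_curl hV
  have hd := continuousOn_curl_curl hV
  have hcr : ContinuousOn (fun p : ℝ × EuclideanSpace ℝ (Fin 3) =>
      cross (curl (V p.1) p.2) (curl (curl (V p.1)) p.2)) (Iio 0 ×ˢ univ) := by
    have h := crossCLM.continuous₂.comp_continuousOn (hb.prodMk hd)
    refine h.congr fun p _ => ?_
    simp [Function.comp, crossCLM_apply]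
  have hL : ContinuousOn (fun p : ℝ × EuclideanSpace ℝ (Fin 3) =>
      ⟪V p.1 p.2, cross (curl (V p.1) p.2) (curl (curl (V p.1)) p.2)⟫) (Iio 0 ×ˢ univ) :=
    ha.inner hcr
  have ht : ContinuousOn (fun p : ℝ × EuclideanSpace ℝ (Fin 3) => 4 * (-p.1)) (Iio 0 ×ˢ univ) :=
    (continuous_const.mul continuous_fst.neg).continuousOn
  have hR : ContinuousOn (fun p : ℝ × EuclideanSpace ℝ (Fin 3) =>
      θ * (‖curl (curl (V p.1)) p.2‖ ^ 2 + ‖curl (V p.1) p.2‖ ^ 2 / (4 * (-p.1)))) (Iio 0 ×ˢ univ) := by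
    refine ((hd.norm.pow 2).add ((hb.norm.pow 2).div ht fun p hp => ?_)).const_smul θ
    have : p.1 < 0 := hp.1
    exact mul_ne_zero four_ne_zero (neg_ne_zero.2 this.ne)
  have hO := (hL.sub hR).isOpen_inter_preimage hS (isOpen_Ioi (a := (0:ℝ)))
  convert hO using 1
  ext p
  simp only [mem_setOf_eq, mem_inter_iff, mem_prod, mem_Iio, mem_univ, and_true, mem_preimage,
    mem_Ioi, Pi.sub_apply, sub_pos, not_le]

/-- **THE LAMB-FORM PRODUCTION EXCESS BY A DEFINITE FACTOR RECURS IN EVERY WINDOW.** For every `A`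
there are `ε(A) ∈ (0,1)`, `δ(A) > 0` such that every singular enveloped member has in every window
`[−c², −εc²]` a point with `(1+δ)(‖curl ω‖² + ‖ω‖²/(4(−t))) < ⟪V, ω × curl ω⟫`.
[folklore energy method + KNSS compactness; cite: KochNadirashviliSereginSverak2009, §4 (arXiv:0709.3599 p. 8)] -/
theorem localBalance_excess_margin_in_every_window (A : ℝ) : ∃ ε : ℝ, 0 < ε ∧ ε < 1 ∧ ∃ δ : ℝ, 0 < δ ∧
    ∀ (C : ℝ) (V : ℝ → EuclideanSpace ℝ (Fin 3) → EuclideanSpace ℝ (Fin 3)),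
      IsTypeIAncientMild C V → C ≤ A → HasTypeIDecay A V →
      (∀ r > 0, ∀ M : ℝ, ∃ t ∈ Ioo (-(r ^ 2)) (0 : ℝ),
        ∃ x ∈ ball (0 : EuclideanSpace ℝ (Fin 3)) r, M < ‖V t x‖) →
      ∀ c : ℝ, 0 < c → ∃ t ∈ Icc (-c ^ 2) (-(ε * c ^ 2)), ∃ x : EuclideanSpace ℝ (Fin 3),
        (1 + δ) * (‖curl (curl (V t)) x‖ ^ 2 + ‖curl (V t) x‖ ^ 2 / (4 * (-t))) <
          ⟪V t x, cross (curl (V t) x) (curl (curl (V t)) x)⟫ := by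
  obtain ⟨ε, hε, hε1, δ, hδ, h⟩ := exists_window_margin_of_apex_kill_envelope (C := A) (θ₀ := 1)
    (G := fun θ F t x => ⟪F t x, cross (curl (F t) x) (curl (curl (F t)) x)⟫ ≤
      θ * (‖curl (curl (F t)) x‖ ^ 2 + ‖curl (F t) x‖ ^ 2 / (4 * (-t))))
    (fun θ F c t x hc ht hG => localBalance_factor_at_nsRescale θ F x hc ht hG)
    (fun u W θ hu hW hunif hpt hgr hθ t ht x hbad =>
      localBalance_factor_violation_eventually hu hW hunif hpt hgr hθ ht x hbad)
    (fun W hW hdW hG => not_singular_of_localBalance_near_apex hW hdW (τ := -1/2) (by norm_num)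
      fun t h1 h2 x => by have := hG t (by linarith) h2 x; rwa [one_mul] at this)
  refine ⟨ε, hε, hε1, δ, hδ, fun C V hV hCA hdec hsing c hc => ?_⟩
  obtain ⟨t, ht, x, hx⟩ := h V (isTypeIAncientMild_of_le hV hCA) hdec hsing c hc
  exact ⟨t, ht, x, not_le.1 hx⟩

/-- **THE LAMB-FORM EXCESS SET WITH FACTOR `1+δ` HAS DEFINITE VOLUME IN THE UNIT WINDOW.**
[folklore energy method + KNSS compactness; cite: KochNadirashviliSereginSverak2009, §4 (arXiv:0709.3599 p. 8)] -/
theorem localBalance_excess_margin_volume (A : ℝ) : ∃ ε : ℝ, 0 < ε ∧ ε < 1 ∧ ∃ δ : ℝ, 0 < δ ∧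
    ∃ η : ℝ, 0 < η ∧
    ∀ (C : ℝ) (V : ℝ → EuclideanSpace ℝ (Fin 3) → EuclideanSpace ℝ (Fin 3)),
      IsTypeIAncientMild C V → C ≤ A → HasTypeIDecay A V →
      (∀ r > 0, ∀ M : ℝ, ∃ t ∈ Ioo (-(r ^ 2)) (0 : ℝ),
        ∃ x ∈ ball (0 : EuclideanSpace ℝ (Fin 3)) r, M < ‖V t x‖) →
      ENNReal.ofReal η ≤ volume {p : ℝ × EuclideanSpace ℝ (Fin 3) | p.1 ∈ Icc (-1 : ℝ) (-ε) ∧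
        (1 + δ) * (‖curl (curl (V p.1)) p.2‖ ^ 2 + ‖curl (V p.1) p.2‖ ^ 2 / (4 * (-p.1))) <
          ⟪V p.1 p.2, cross (curl (V p.1) p.2) (curl (curl (V p.1)) p.2)⟫} := by
  obtain ⟨ε, hε, hε1, δ, hδ, η, hη, h⟩ := exists_window_margin_volume_of_apex_kill_envelope (C := A)
    (θ₀ := 1)
    (G := fun θ F t x => ⟪F t x, cross (curl (F t) x) (curl (curl (F t)) x)⟫ ≤
      θ * (‖curl (curl (F t)) x‖ ^ 2 + ‖curl (F t) x‖ ^ 2 / (4 * (-t))))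
    (fun u W θ hu hW hunif hpt hgr hθ t ht x hbad =>
      localBalance_factor_violation_eventually hu hW hunif hpt hgr hθ ht x hbad)
    (fun θ U hU _ => isOpen_localBalance_factor_violation hU θ)
    (fun W hW hdW hG => not_singular_of_localBalance_near_apex hW hdW (τ := -1/2) (by norm_num)
      fun t h1 h2 x => by have := hG t (by linarith) h2 x; rwa [one_mul] at this)
  refine ⟨ε, hε, hε1, δ, hδ, η, hη, fun C V hV hCA hdec hsing => ?_⟩
  exact (h V (isTypeIAncientMild_of_le hV hCA) hdec hsing).trans
    (measure_mono fun p hp => ⟨hp.1, not_le.1 hp.2⟩)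

end Balance

/-! ### The one-window regularity criteria -/

section Criteria

/-- **ONE SLOW WINDOW SUFFICES (law-free regularity criterion).** There are `ε(A) ∈ (0,1)`,
`δ(A) > 0`: a KNSS-gauge Type-I field (`IsTypeIAncientMild C V`, `C ≤ A`) with a Type-I envelope
`HasTypeIDecay A V` such that `√(−t)‖V(t,x)‖ ≤ 1 + δ` for all `(t,x)` in ONE window
`[−c², −εc²] × ℝ³` (some `c > 0`) is NOT singular at the apex. [folklore + KNSS compactness;
cite: KochNadirashviliSereginSverak2009, §4 (arXiv:0709.3599 p. 8)] -/
theorem not_singular_of_slow_window (A : ℝ) : ∃ ε : ℝ, 0 < ε ∧ ε < 1 ∧ ∃ δ : ℝ, 0 < δ ∧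
    ∀ (C : ℝ) (V : ℝ → EuclideanSpace ℝ (Fin 3) → EuclideanSpace ℝ (Fin 3)),
      IsTypeIAncientMild C V → C ≤ A → HasTypeIDecay A V →
      ∀ c : ℝ, 0 < c →
      (∀ t ∈ Icc (-c ^ 2) (-(ε * c ^ 2)), ∀ x : EuclideanSpace ℝ (Fin 3),
        Real.sqrt (-t) * ‖V t x‖ ≤ 1 + δ) →
      ¬ (∀ r > 0, ∀ M : ℝ, ∃ t ∈ Ioo (-(r ^ 2)) (0 : ℝ),
        ∃ x ∈ ball (0 : EuclideanSpace ℝ (Fin 3)) r, M < ‖V t x‖) := by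
  obtain ⟨ε, hε, hε1, δ, hδ, h⟩ := speed_exceeds_margin_in_every_window A
  refine ⟨ε, hε, hε1, δ, hδ, fun C V hV hCA hdec c hc hslow hsing => ?_⟩
  obtain ⟨t, ht, x, hx⟩ := h C V hV hCA hdec hsing c hc
  exact (not_le.2 hx) (hslow t ht x)

/-- **SMALL FAST VOLUME IN ONE WINDOW SUFFICES.** There are `ε(A) ∈ (0,1)`, `δ(A) > 0`,
`η(A) > 0`: an enveloped KNSS-gauge Type-I field whose fast set `{√(−t)‖V‖ > 1 + δ}` meets ONE
window `[−c², −εc²] × ℝ³` in volume `< η c⁵` is NOT singular at the apex. [folklore + KNSS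
compactness; cite: KochNadirashviliSereginSverak2009, §4 (arXiv:0709.3599 p. 8)] -/
theorem not_singular_of_small_fast_volume (A : ℝ) : ∃ ε : ℝ, 0 < ε ∧ ε < 1 ∧ ∃ δ : ℝ, 0 < δ ∧
    ∃ η : ℝ, 0 < η ∧
    ∀ (C : ℝ) (V : ℝ → EuclideanSpace ℝ (Fin 3) → EuclideanSpace ℝ (Fin 3)),
      IsTypeIAncientMild C V → C ≤ A → HasTypeIDecay A V →
      ∀ c : ℝ, 0 < c →
      volume {p : ℝ × EuclideanSpace ℝ (Fin 3) |
          p.1 ∈ Icc (-c ^ 2) (-(ε * c ^ 2)) ∧ 1 + δ < Real.sqrt (-p.1) * ‖V p.1 p.2‖} <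
        ENNReal.ofReal (η * c ^ 5) →
      ¬ (∀ r > 0, ∀ M : ℝ, ∃ t ∈ Ioo (-(r ^ 2)) (0 : ℝ),
        ∃ x ∈ ball (0 : EuclideanSpace ℝ (Fin 3)) r, M < ‖V t x‖) := by
  obtain ⟨ε, hε, hε1, δ, hδ, η, hη, h⟩ := speed_exceeds_margin_volume_scaled A
  refine ⟨ε, hε, hε1, δ, hδ, η, hη, fun C V hV hCA hdec c hc hvol hsing => ?_⟩
  exact (not_le.2 hvol) (h C V hV hCA hdec hsing c hc)

/-- **FEW FAST INSTANTS IN ONE WINDOW SUFFICE.** There are `ε(A) ∈ (0,1)`, `κ(A) > 0`: an enveloped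
KNSS-gauge Type-I field such that, in ONE window `[−c², −εc²]`, the instants at which some point
has `√(−t)‖V‖ > 1` form a set of measure `< κ c²`, is NOT singular at the apex. [folklore + KNSS
compactness; cite: KochNadirashviliSereginSverak2009, §4 (arXiv:0709.3599 p. 8)] -/
theorem not_singular_of_few_fast_times (A : ℝ) : ∃ ε : ℝ, 0 < ε ∧ ε < 1 ∧ ∃ κ : ℝ, 0 < κ ∧
    ∀ (C : ℝ) (V : ℝ → EuclideanSpace ℝ (Fin 3) → EuclideanSpace ℝ (Fin 3)),
      IsTypeIAncientMild C V → C ≤ A → HasTypeIDecay A V →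
      ∀ c : ℝ, 0 < c →
      volume {t : ℝ | t ∈ Icc (-c ^ 2) (-(ε * c ^ 2)) ∧ ∃ x, 1 < Real.sqrt (-t) * ‖V t x‖} <
        ENNReal.ofReal (κ * c ^ 2) →
      ¬ (∀ r > 0, ∀ M : ℝ, ∃ t ∈ Ioo (-(r ^ 2)) (0 : ℝ),
        ∃ x ∈ ball (0 : EuclideanSpace ℝ (Fin 3)) r, M < ‖V t x‖) := by
  obtain ⟨ε, hε, hε1, κ, hκ, h⟩ := fastTimes_measure_ge A
  refine ⟨ε, hε, hε1, κ, hκ, fun C V hV hCA hdec c hc hvol hsing => ?_⟩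
  exact (not_le.2 hvol) (h C V hV hCA hdec hsing c hc)

end Criteria

end Summit.NavierStokesRegularity.NavierStokesRegularity.Theorems.FiniteDissipationLiouville.WindowRecurrence

end
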